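import Literature.MathematicalPhysics.QuantumFieldTheory.Balaban1983to89.B9Eq342GreenPrimeTowerSupBoundDecay
import Literature.MathematicalPhysics.QuantumFieldTheory.Balaban1983to89.B9Eq342GreenPrimeSupBoundDecayCosh
import Literature.MathematicalPhysics.QuantumFieldTheory.Balaban1983to89.B5Eq129FreeResolventDecayedLetterSiteDiag

/-!
# `Balaban1983to89.B9Eq342GreenPrimeTowerSupBoundDecayCosh` — T. Bałaban, *Propagators for lattice gauge theories in a background field*, Commun. Math.
# Phys. **99** (1985) 389–434 [Balaban1985BackgroundPropagators] Thm 3.1 (3.42) p. 397 («δ₀, B₀ dependent on d and L only»), FIRST ENTRY WITH DECAY AT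
# `k = n+1` LEVELS FOR PRINT's `G′_k(U)` (`B9Eq324DeltaPrimeATower.GpOfUk`), **THE JUNCTION: (W) + (D-FS) + (T) INHABITED AT THE TOWER AND THE CONSTANTS
# READ ON THE DIAGONAL `ηL^{n+1} = 1`, `c₀(L^{n+1})^d = c₁` FREE OF THE HEIGHT `n`, OF `L` AND OF THE VOLUME** — `‖(G′_k(U)f)(x₀)‖ ≤ (B₁ + B₂)·K_d(κ′)·sup|f|`
# for every `f`, with, at the rate `a⋆ = √(1∕(4d(L^{n+1})² + 1))` of `B9Eq342GreenPrimeSupBoundDecayCosh.rate_explicit`: `λ ≥ 1∕2`, block rate `κ₁ = a⋆L^{n+1} ≥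
# 1∕√(4d+1)`, `M = 2e^{a⋆(L^{n+1}−1)} ≤ 2√e`, `C₃ = √(3^d∕c₁·λ^{−k}) ≤ √(3^d∕c₁·2^k)` (ne9-leaf-02 g72's level-free (D-FS) letter
# `B5Eq129FreeResolventDecayedLetterSiteDiag.hDFS_cosh_site_diag`), hence `B₁ ≤ (1 + p₂C_E√μ)·2√e·Σ_{l<k}2^{l+1}`, `B₂ ≤ √(3^d2^k∕c₁)·√(2√e·K_d(1∕√(4d+1) − 2κ′))·C_E·√μ`
# — modulo EXACTLY the displayed letters (D-P)k (`p₂`; inhabitant ne9-leaf-03's `B9Eq324PenaltyBlockLocal` §2, `p₂ = |a′|∕√c₁`), the one-block masses (`μ`;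
# `μ = c₁`, ibid. §3) and (D-E)k (`C_E`, `κ` — the big-block `L²` decay of `G′_k(U)`, OPEN) — the TOWER TWIN of `B9Eq342GreenPrimeSupBoundDecayCosh`
# (storey (D) of the NE9 owner's sup-norm programme, plan v10 §5; `t4/b2b-balaban-t4-ne9-p1/g90/STOREY-D-ASSEMBLY.md` §3 «PRECISION» + «RATE»)

statement-level skeleton of published theorems with citation tags; proofs where landed; nothing here is a claim about the Yang–Mills mass gap

CITATION HEADER (lean-in-tree rule).  Audit cell `pub-balaban`, sub-cell `t4`, BINDER row NE9; filed by the NE9 BINDER-row OWNER lineage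
`b2b-balaban-t4-ne9-p1` (gen 91).  Composed BY NAME: this lineage's `B9Eq342GreenPrimeTowerSupBoundDecay` (the tower row with letters displayed),
`B9Eq342CoshWeightSite` §1 (the `cosh` weight on `TSite d P` — `P`-GENERIC: positivity, normalisation, supersolution) and
`B9Eq342GreenPrimeSupBoundDecayCosh.rate_explicit`; ne9-leaf-06 g70's `B9Eq342CoshWeightBlockDistance.exp_mul_tdist_le_two_mul_weight_torCast` (`P`-generic)
with ne9-leaf-03 g71's `B9Eq342TowerBigBlocks.mul_tdist_bigBlock_sub_le_tdist` (the tower's `hWd`, geometric half); ne9-leaf-02 g72's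
`B5Eq129FreeResolventDecayedLetterSiteDiag.hDFS_cosh_site_diag` (OFFER O-1, journal l.56979; owner's word W-1 l.58263 «THIS SHAPE — file it»).  Sources READ
first-hand (`paper:balaban1985-cmp99-background-propagators`): p. 397 Thm 3.1, p. 394 (3.23)–(3.25), p. 393 (3.19), p. 399 (3.49); [Balaban1984PropagatorsI]
p. 36 (the `cosh` weight device).  NOTHING of print's random-walk proof (pp. 415–426) is reproduced.

WHAT IS PROVED (sorry-free; proof lane — no `def`, no `Prop` placeholder; [folklore] bookkeeping over named letters).
* §0 **`exp_bigBlockDist_le_weight_site`** (the TOWER `hWd`: `e^{aL^{n+1}·d_m(Πx₀,Πx)} ≤ e^{a(L^{n+1}−1)}·2·W_{x₀}(x)` for the `cosh` weight centred at `x₀` on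
  `T_{(L^{n+1}m)}`); **`weight_site_letters_tower`** (the four (W) binders of `B9Eq342GreenPrimeTowerSupBoundDecay` at once); private `latticeConst_anti`
  (`K_d` is antitone in the rate, `1 ≤ d`; a ten-line twin of the cell's `B3Op116ScaleChains.latticeConst_antitone`, not imported to keep this file inside [B9]).
* §1 **`norm_GpOfUk_apply_le_decay_cosh`**, **`norm_GpOfUk_apply_le_rowSum_cosh`**, **`…_rowSum_cosh_unitary`**: the tower row with (W)+(D-FS)+(T) inhabited,
  any rate `0 ≤ a` with `0 < λ = 1 − 2d·η⁻²(cosh a − 1)`, `k ≥ d`, `0 < η⁻¹ ≤ L^{n+1}m_ν`, `c₀η^{−d} = c₁`, rates `0 ≤ κ′ ≤ κ`, `2κ′ < aL^{n+1}`; displayed: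
  (D-P)k `hP`, (D-E)k `hdec`, the data `‖f(y)‖ ≤ F`, `‖P_vf‖ ≤ √μF`.
* §2 **`norm_GpOfUk_apply_le_rowSum_heightFree`** (`1 ≤ d`, the diagonal `η⁻¹ = L^{n+1}`, `c₀(L^{n+1})^d = c₁`, `k ≥ d`, `0 < κ′`, `2κ′ < 1∕√(4d+1)`, `κ′ ≤ κ`):
  `‖(G′_k(U)f)(x₀)‖ ≤ ((1 + p₂C_E√μ)·(2e^{1∕2})·Σ_{l<k}2^{l+1} + √(3^d∕c₁·2^k)·√(2e^{1∕2}·K_d(1∕√(4d+1) − 2κ′))·C_E·√μ)·K_d(κ′)·sup|f|` — EVERY CONSTANT FREE OF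
  `n`, `L`, `m`, `η`: print's «B₀ dependent on d (and L) only» for the chain's `G′_k(U)`, modulo (T), (D-P)k, (D-E)k and the masses; **`…_heightFree_unitary`**.
HONEST SCOPE.  VALUE row only; (D-E)k is DISPLAYED, NOT inhabited (no tree file states the big-block `L²` decay of `GpOfUk`; road B8″'s
`exists_block_decay_Gp` is one-step); no ∇-row, no Hölder rows (3.40), no (3.43)–(3.47), no random walk; «NE9 ⇐ the named binders»; NE9 NOT PRINTED ∕
NOT PROVED; row WALLED ON A MODEL (O-NE9-1; NEEDS-COORDINATOR #5 UNRULED); spine PROVED 0∕9; rung (B)+1 on a finite T⁴ — NOT infinite volume, NOT mass gap,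
NOT BetaPertH, NOT Clay.  HONEST DEPENDENCY: continuum YM on T⁴ ⇐ BetaPertH ∧ nine spine estimates (0/9 proved); BetaPertH ⇐ (D1) ∧ (D4) ∧ CAP+tail;
G-an2-4 gates asym, D1 and NE2/3/4.  NEW file; nothing modified.  Net new unproved facts: 0.
-/

noncomputable section

open scoped InnerProductSpace ComplexConjugate BigOperators

namespace Literature.MathematicalPhysics.QuantumFieldTheory.Balaban1983to89.B9Eq342GreenPrimeTowerSupBoundDecayCosh

open B4Sect5Torus (TSite tdist tdist_nonneg)
open B4Sect5Proof (latticeConst latticeConst_nonneg)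
open B4TorusKernel.MultiPeriod (circAbs)
open B9SectCLatticeCarrier (Bond shift unshift)
open B9Eq311L2Pairing (WL2)
open B11Eq103H1Complex (SiteL2K covLaplaceSiteK)
open B9Eq310HessianOperator (adTransportW)
open B9Eq319QprimeTorus (fineP blockCoord)
open B9Eq315QTower (towerP towerP_apply)
open B9Eq316TowerFlatIsOneStep (towerP_eq_fineP_pow siteCast)
open B9Eq324DeltaPrimeATower (laplacePrimeAk GpOfUk)
open B9Eq342GreenPrimeSupBound (norm_adTransportW_eq norm_adTransportW_inv_eq)
open B9Eq342TowerBigBlocks (mul_tdist_bigBlock_sub_le_tdist)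
open B9Eq342CoshWeightBlockDistance (exp_mul_tdist_le_two_mul_weight_torCast)
open B9Eq342CoshWeightSite (weight_site_pos weight_site_centre weight_site_supersolution)
open B9Eq342GreenPrimeSupBoundDecayCosh (rate_explicit)
open B5Eq129FreeResolventDecayedLetterSiteDiag (hDFS_cosh_site_diag)
open B9Eq342GreenPrimeTowerSupBoundDecay (norm_GpOfUk_apply_le_decay norm_GpOfUk_apply_le_rowSum)

variable {d : ℕ} (L : ℕ) [NeZero L] (m : Fin d → ℕ) [∀ i, NeZero (m i)] (n : ℕ)
  {𝔸 : Type*} [NormedRing 𝔸] [NormedAlgebra ℂ 𝔸] [CompleteSpace 𝔸]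
  {W : Type*} [NormedAddCommGroup W] [InnerProductSpace ℂ W] [FiniteDimensional ℂ W] (φ : W ≃ₗ[ℂ] 𝔸) {c₀ : ℝ} [Fact (0 < c₀)]
  (η : ℝ) (U : Bond d (towerP L m (n + 1)) → 𝔸ˣ) {c₁ : ℝ} [Fact (0 < c₁)] (a' : ℝ)
  (hpos' : ∀ x : SiteL2K ℂ d (towerP L m (n + 1)) c₀ W, x ≠ 0 → 0 < RCLike.re ⟪x, laplacePrimeAk L m n φ η U a' (c₁ := c₁) x⟫_ℂ)

/-! ## §0 The tower's weight letters: the `cosh` weight centred at a fine site of `T_{(L^{n+1}m)}` -/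

/-- **THE TOWER's `hWd`**: for the `cosh` product weight `W_{x₀}` of rate `a ≥ 0` centred at `x₀ ∈ T_{(L^{n+1}m)}` and the big-block map
`Π = blockCoord (L^{n+1}) m ∘ siteCast`: `e^{aL^{n+1}·d_m(Πx₀, Πx)} ≤ e^{a(L^{n+1}−1)}·2·W_{x₀}(x)` — ne9-leaf-03's two-sided block geometry
(`L^{n+1}·d_m(Πx₀,Πx) − (L^{n+1}−1) ≤ d_{(L^{n+1}m)}(x₀,x)`) and ne9-leaf-06's `e^{a·d_P(x₀,x)} ≤ 2·W_{x₀}(x)`; the block rate is `κ₁ = aL^{n+1}`, the factor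
`M = 2e^{a(L^{n+1}−1)}`. [folklore] [cite: Balaban1985BackgroundPropagators, Thm 3.1 (3.42) p.397, (3.49) p.399, (3.19) p.393; Balaban1984PropagatorsI, p.36] -/
theorem exp_bigBlockDist_le_weight_site {a : ℝ} (ha : 0 ≤ a) (x₀ x : TSite d (towerP L m (n + 1))) :
    Real.exp (a * (L : ℝ) ^ (n + 1) * tdist m (blockCoord (L ^ (n + 1)) m (siteCast (towerP_eq_fineP_pow L m (n + 1)) x₀))
        (blockCoord (L ^ (n + 1)) m (siteCast (towerP_eq_fineP_pow L m (n + 1)) x))) ≤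
      Real.exp (a * ((L : ℝ) ^ (n + 1) - 1)) * 2 *
        ∏ μ, Real.cosh (a * (circAbs (towerP L m (n + 1) μ) (((((x₀ μ : ℕ) : ZMod (towerP L m (n + 1) μ)) -
          ((x μ : ℕ) : ZMod (towerP L m (n + 1) μ))).val : ℕ) : ℤ) : ℝ)) := by
  have hm : ∀ i, 1 ≤ m i := fun i => Nat.one_le_iff_ne_zero.mpr (NeZero.ne (m i))
  have h1 := mul_tdist_bigBlock_sub_le_tdist L m (n + 1) hm x₀ x
  have h2 := exp_mul_tdist_le_two_mul_weight_torCast a x₀ x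
  set D : ℝ := tdist m (blockCoord (L ^ (n + 1)) m (siteCast (towerP_eq_fineP_pow L m (n + 1)) x₀))
    (blockCoord (L ^ (n + 1)) m (siteCast (towerP_eq_fineP_pow L m (n + 1)) x))
  calc Real.exp (a * (L : ℝ) ^ (n + 1) * D)
      = Real.exp (a * ((L : ℝ) ^ (n + 1) - 1)) * Real.exp (a * ((L : ℝ) ^ (n + 1) * D - ((L : ℝ) ^ (n + 1) - 1))) := by
        rw [← Real.exp_add]; congr 1; ring
    _ ≤ Real.exp (a * ((L : ℝ) ^ (n + 1) - 1)) * Real.exp (a * tdist (towerP L m (n + 1)) x₀ x) :=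
        mul_le_mul_of_nonneg_left (Real.exp_le_exp.2 (mul_le_mul_of_nonneg_left h1 ha)) (Real.exp_pos _).le
    _ ≤ Real.exp (a * ((L : ℝ) ^ (n + 1) - 1)) * (2 * ∏ μ, Real.cosh (a * (circAbs (towerP L m (n + 1) μ)
          (((((x₀ μ : ℕ) : ZMod (towerP L m (n + 1) μ)) - ((x μ : ℕ) : ZMod (towerP L m (n + 1) μ))).val : ℕ) : ℤ) : ℝ))) :=
        mul_le_mul_of_nonneg_left h2 (Real.exp_pos _).le
    _ = _ := by ring

/-- **THE FOUR (W) BINDERS OF `B9Eq342GreenPrimeTowerSupBoundDecay` AT ONCE** for the `cosh` weight centred at `x₀ ∈ T_{(L^{n+1}m)}`: `0 < W`, `W(x₀) = 1`,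
the supersolution inequality `λW ≤ (L₀+1)W` of the flat `η⁻²`-stencil with `λ = 1 − 2d·η⁻²(cosh a − 1)` (`B9Eq342CoshWeightSite` §1, `P := towerP L m (n+1)`),
and the tower `hWd` with `κ₁ = aL^{n+1}`, `M = 2e^{a(L^{n+1}−1)}`. [folklore] [cite: Balaban1985BackgroundPropagators, Thm 3.1 (3.42) p.397; Balaban1984PropagatorsI, p.36] -/
theorem weight_site_letters_tower {a : ℝ} (ha : 0 ≤ a) (x₀ : TSite d (towerP L m (n + 1))) :
    (∀ x : TSite d (towerP L m (n + 1)), 0 < ∏ μ, Real.cosh (a * (circAbs (towerP L m (n + 1) μ)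
        (((((x₀ μ : ℕ) : ZMod (towerP L m (n + 1) μ)) - ((x μ : ℕ) : ZMod (towerP L m (n + 1) μ))).val : ℕ) : ℤ) : ℝ))) ∧
      (∏ μ, Real.cosh (a * (circAbs (towerP L m (n + 1) μ)
        (((((x₀ μ : ℕ) : ZMod (towerP L m (n + 1) μ)) - ((x₀ μ : ℕ) : ZMod (towerP L m (n + 1) μ))).val : ℕ) : ℤ) : ℝ)) = 1) ∧
      (∀ x : TSite d (towerP L m (n + 1)), (1 - 2 * d * (η⁻¹) ^ 2 * (Real.cosh a - 1)) *
          ∏ μ, Real.cosh (a * (circAbs (towerP L m (n + 1) μ)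
            (((((x₀ μ : ℕ) : ZMod (towerP L m (n + 1) μ)) - ((x μ : ℕ) : ZMod (towerP L m (n + 1) μ))).val : ℕ) : ℤ) : ℝ)) ≤
        ∑ j : Fin d ⊕ Fin d, (η⁻¹) ^ 2 *
            (∏ μ, Real.cosh (a * (circAbs (towerP L m (n + 1) μ)
                (((((x₀ μ : ℕ) : ZMod (towerP L m (n + 1) μ)) - ((x μ : ℕ) : ZMod (towerP L m (n + 1) μ))).val : ℕ) : ℤ) : ℝ)) -
              ∏ μ, Real.cosh (a * (circAbs (towerP L m (n + 1) μ) (((((x₀ μ : ℕ) : ZMod (towerP L m (n + 1) μ)) -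
                (((Sum.elim (fun ν => unshift ν x) (fun ν => shift ν x) j : TSite d (towerP L m (n + 1))) μ : ℕ) :
                  ZMod (towerP L m (n + 1) μ))).val : ℕ) : ℤ) : ℝ))) +
          1 * ∏ μ, Real.cosh (a * (circAbs (towerP L m (n + 1) μ)
            (((((x₀ μ : ℕ) : ZMod (towerP L m (n + 1) μ)) - ((x μ : ℕ) : ZMod (towerP L m (n + 1) μ))).val : ℕ) : ℤ) : ℝ))) ∧
      (∀ x : TSite d (towerP L m (n + 1)), Real.exp (a * (L : ℝ) ^ (n + 1) *
          tdist m (blockCoord (L ^ (n + 1)) m (siteCast (towerP_eq_fineP_pow L m (n + 1)) x₀))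
            (blockCoord (L ^ (n + 1)) m (siteCast (towerP_eq_fineP_pow L m (n + 1)) x))) ≤
        Real.exp (a * ((L : ℝ) ^ (n + 1) - 1)) * 2 *
          ∏ μ, Real.cosh (a * (circAbs (towerP L m (n + 1) μ) (((((x₀ μ : ℕ) : ZMod (towerP L m (n + 1) μ)) -
            ((x μ : ℕ) : ZMod (towerP L m (n + 1) μ))).val : ℕ) : ℤ) : ℝ))) :=
  ⟨fun x => weight_site_pos (towerP L m (n + 1)) a x₀ x, weight_site_centre (towerP L m (n + 1)) a x₀,
    fun x => weight_site_supersolution (towerP L m (n + 1)) a (η⁻¹) 1 x₀ x,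
    fun x => exp_bigBlockDist_le_weight_site L m n ha x₀ x⟩

omit [NeZero L] [∀ i, NeZero (m i)] in
/-- `K_d` is antitone in the rate (`1 ≤ d`): `0 < a ≤ b ⟹ K_d(b) ≤ K_d(a)` (private twin of the cell's `B3Op116ScaleChains.latticeConst_antitone`). [folklore] -/
private theorem latticeConst_anti (hd : 1 ≤ d) {a b : ℝ} (ha : 0 < a) (hab : a ≤ b) : latticeConst d b ≤ latticeConst d a := by
  unfold latticeConst
  have hdp : (0 : ℝ) < d := by exact_mod_cast hd
  have hea : Real.exp (-(b / d)) ≤ Real.exp (-(a / d)) :=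
    Real.exp_le_exp.mpr (neg_le_neg (div_le_div_of_nonneg_right hab hdp.le))
  have hpa : 0 < 1 - Real.exp (-(a / d)) := by
    have : Real.exp (-(a / d)) < 1 := Real.exp_lt_one_iff.mpr (by have := div_pos ha hdp; linarith)
    linarith
  have hinv : (1 - Real.exp (-(b / d)))⁻¹ ≤ (1 - Real.exp (-(a / d)))⁻¹ := inv_anti₀ hpa (by linarith)
  exact pow_le_pow_left₀ (mul_nonneg (by norm_num) (inv_nonneg.mpr (by linarith))) (mul_le_mul_of_nonneg_left hinv (by norm_num)) d

/-! ## §1 The junction at the tower: (W) + (D-FS) + (T) inhabited, any rate -/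

/-- **(3.42) FIRST ENTRY WITH DECAY FOR `G′_k(U)`, ONE-BIG-BLOCK SOURCE, (W)+(D-FS) INHABITED** by the `cosh` weight centred at `x₀` and ne9-leaf-02's LEVEL-FREE
(D-FS) letter: for `f` supported in `B^k(v)`, `‖f(y)‖ ≤ F`, `‖f‖ ≤ √μF`, any rate `0 ≤ a` with `0 < λ = 1 − 2d·η⁻²(cosh a − 1)`, `d ≤ k`, `0 < η⁻¹ ≤ L^{n+1}m_ν`,
`c₀η^{−d} = c₁`, `0 ≤ κ′ ≤ κ`, `2κ′ < aL^{n+1}`: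
`‖(G′_k(U)f)(x₀)‖ ≤ ((1 + p₂C_E√μ)·2e^{a(L^{n+1}−1)}·Σ_{l<k}λ^{−(l+1)} + √(3^d∕c₁·λ^{−k})·√(2e^{a(L^{n+1}−1)}·K_d(aL^{n+1} − 2κ′))·C_E·√μ)·e^{−κ′d_m(Πx₀,v)}·F` — letters
(T), (D-P)k, (D-E)k displayed. [cite: Balaban1985BackgroundPropagators, Thm 3.1 (3.42) p.397, (3.24)–(3.25) p.394, (3.19) p.393] -/
theorem norm_GpOfUk_apply_le_decay_cosh
    (hR : ∀ b w, ‖adTransportW φ U b w‖ ≤ ‖w‖) (hS : ∀ b w, ‖adTransportW φ (fun b => (U b)⁻¹) b w‖ ≤ ‖w‖)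
    {PS : TSite d m → SiteL2K ℂ d (towerP L m (n + 1)) c₀ W →L[ℂ] SiteL2K ℂ d (towerP L m (n + 1)) c₀ W}
    (hPS : ∀ (y : TSite d m) (g : SiteL2K ℂ d (towerP L m (n + 1)) c₀ W) (x : TSite d (towerP L m (n + 1))),
      WL2.equiv ℂ (fun _ : TSite d (towerP L m (n + 1)) => c₀) W (PS y g) x =
        if blockCoord (L ^ (n + 1)) m (siteCast (towerP_eq_fineP_pow L m (n + 1)) x) = y then
          WL2.equiv ℂ (fun _ : TSite d (towerP L m (n + 1)) => c₀) W g x else 0)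
    {p₂ CE κ κ' a : ℝ} (hp₂ : 0 ≤ p₂) (hCE : 0 ≤ CE) (ha : 0 ≤ a) (hlam : 0 < 1 - 2 * d * (η⁻¹) ^ 2 * (Real.cosh a - 1))
    {k : ℕ} (hk : d ≤ k) (hη : 0 < η⁻¹) (hdiag : c₀ * (η⁻¹) ^ d = c₁) (hvol : ∀ ν, η⁻¹ ≤ (towerP L m (n + 1) ν : ℝ))
    (hκ' : 0 ≤ κ') (hκ : κ' ≤ κ) (hκ₁ : 2 * κ' < a * (L : ℝ) ^ (n + 1))
    (hP : ∀ (v : SiteL2K ℂ d (towerP L m (n + 1)) c₀ W) (x : TSite d (towerP L m (n + 1))),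
      ‖WL2.equiv ℂ _ W (laplacePrimeAk L m n φ η U a' (c₁ := c₁) v -
        covLaplaceSiteK ((η : ℂ))⁻¹ (adTransportW φ U) (adTransportW φ fun b => (U b)⁻¹) v) x‖ ≤
        p₂ * ‖PS (blockCoord (L ^ (n + 1)) m (siteCast (towerP_eq_fineP_pow L m (n + 1)) x)) v‖)
    {v : TSite d m}
    (hdec : ∀ y : TSite d m, ‖PS y ∘L LinearMap.toContinuousLinearMap (GpOfUk L m n φ η U a' hpos') ∘L PS v‖ ≤
      CE * Real.exp (-(κ * tdist m v y)))
    (x₀ : TSite d (towerP L m (n + 1))) (f : SiteL2K ℂ d (towerP L m (n + 1)) c₀ W)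
    (hfv : ∀ x, blockCoord (L ^ (n + 1)) m (siteCast (towerP_eq_fineP_pow L m (n + 1)) x) ≠ v → WL2.equiv ℂ _ W f x = 0)
    {F μ : ℝ} (hF : ∀ y, ‖WL2.equiv ℂ _ W f y‖ ≤ F) (hμ : ‖f‖ ≤ Real.sqrt μ * F) :
    ‖WL2.equiv ℂ _ W (GpOfUk L m n φ η U a' hpos' f) x₀‖ ≤
      ((1 + p₂ * CE * Real.sqrt μ) * (Real.exp (a * ((L : ℝ) ^ (n + 1) - 1)) * 2) *
            (∑ l ∈ Finset.range k, ((1 - 2 * d * (η⁻¹) ^ 2 * (Real.cosh a - 1)) ^ (l + 1))⁻¹) +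
        Real.sqrt (3 ^ d / c₁ * ((1 - 2 * d * (η⁻¹) ^ 2 * (Real.cosh a - 1)) ^ k)⁻¹) *
          Real.sqrt ((Real.exp (a * ((L : ℝ) ^ (n + 1) - 1)) * 2) * latticeConst d (a * (L : ℝ) ^ (n + 1) - 2 * κ')) * CE * Real.sqrt μ) *
        Real.exp (-(κ' * tdist m (blockCoord (L ^ (n + 1)) m (siteCast (towerP_eq_fineP_pow L m (n + 1)) x₀)) v)) * F := by
  obtain ⟨hW0, hx₀, hsup, hWd⟩ := weight_site_letters_tower L m n η ha x₀
  exact norm_GpOfUk_apply_le_decay L m n φ η U a' hpos' (c₁ := c₁) hR hS hPS hp₂ hCE (Real.sqrt_nonneg _) (by positivity) hlam hκ' hκ hκ₁ hP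
    hdec hW0 hx₀ hsup hWd (fun ψ _ hψ => hDFS_cosh_site_diag (towerP L m (n + 1)) hk a η hη (Fact.out : 0 < c₀) hdiag hvol hlam x₀ ψ hψ)
    f hfv hF hμ

/-- **THE ROW SUM OF (3.42) FOR `G′_k(U)`, (W)+(D-FS) INHABITED**: for EVERY `f` with `‖f(x)‖ ≤ F` and one-big-block masses `‖P_vf‖ ≤ √μF`, (D-E)k for every
source block, `0 < κ′ ≤ κ`, `2κ′ < aL^{n+1}`, `0 < λ`, `d ≤ k`, `0 < η⁻¹ ≤ L^{n+1}m_ν`, `c₀η^{−d} = c₁`: `‖(G′_k(U)f)(x₀)‖ ≤ (B₁ + B₂)·K_d(κ′)·F` — the `L^∞ → L^∞`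
bound of `G′_k(U)` at the output site `x₀`, VOLUME-FREE, modulo (T), (D-P)k, (D-E)k. [cite: Balaban1985BackgroundPropagators, Thm 3.1 (3.42) p.397, (3.39) p.397, (3.49) p.399] -/
theorem norm_GpOfUk_apply_le_rowSum_cosh
    (hR : ∀ b w, ‖adTransportW φ U b w‖ ≤ ‖w‖) (hS : ∀ b w, ‖adTransportW φ (fun b => (U b)⁻¹) b w‖ ≤ ‖w‖)
    {PS : TSite d m → SiteL2K ℂ d (towerP L m (n + 1)) c₀ W →L[ℂ] SiteL2K ℂ d (towerP L m (n + 1)) c₀ W}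
    (hPS : ∀ (y : TSite d m) (g : SiteL2K ℂ d (towerP L m (n + 1)) c₀ W) (x : TSite d (towerP L m (n + 1))),
      WL2.equiv ℂ (fun _ : TSite d (towerP L m (n + 1)) => c₀) W (PS y g) x =
        if blockCoord (L ^ (n + 1)) m (siteCast (towerP_eq_fineP_pow L m (n + 1)) x) = y then
          WL2.equiv ℂ (fun _ : TSite d (towerP L m (n + 1)) => c₀) W g x else 0)
    {p₂ CE κ κ' a : ℝ} (hp₂ : 0 ≤ p₂) (hCE : 0 ≤ CE) (ha : 0 ≤ a) (hlam : 0 < 1 - 2 * d * (η⁻¹) ^ 2 * (Real.cosh a - 1))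
    {k : ℕ} (hk : d ≤ k) (hη : 0 < η⁻¹) (hdiag : c₀ * (η⁻¹) ^ d = c₁) (hvol : ∀ ν, η⁻¹ ≤ (towerP L m (n + 1) ν : ℝ))
    (hκ' : 0 < κ') (hκ : κ' ≤ κ) (hκ₁ : 2 * κ' < a * (L : ℝ) ^ (n + 1))
    (hP : ∀ (v : SiteL2K ℂ d (towerP L m (n + 1)) c₀ W) (x : TSite d (towerP L m (n + 1))),
      ‖WL2.equiv ℂ _ W (laplacePrimeAk L m n φ η U a' (c₁ := c₁) v -
        covLaplaceSiteK ((η : ℂ))⁻¹ (adTransportW φ U) (adTransportW φ fun b => (U b)⁻¹) v) x‖ ≤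
        p₂ * ‖PS (blockCoord (L ^ (n + 1)) m (siteCast (towerP_eq_fineP_pow L m (n + 1)) x)) v‖)
    (hdec : ∀ v y : TSite d m, ‖PS y ∘L LinearMap.toContinuousLinearMap (GpOfUk L m n φ η U a' hpos') ∘L PS v‖ ≤
      CE * Real.exp (-(κ * tdist m v y)))
    (x₀ : TSite d (towerP L m (n + 1))) (f : SiteL2K ℂ d (towerP L m (n + 1)) c₀ W) {F μ : ℝ} (hF : ∀ y, ‖WL2.equiv ℂ _ W f y‖ ≤ F)
    (hμ : ∀ v, ‖PS v f‖ ≤ Real.sqrt μ * F) :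
    ‖WL2.equiv ℂ _ W (GpOfUk L m n φ η U a' hpos' f) x₀‖ ≤
      ((1 + p₂ * CE * Real.sqrt μ) * (Real.exp (a * ((L : ℝ) ^ (n + 1) - 1)) * 2) *
            (∑ l ∈ Finset.range k, ((1 - 2 * d * (η⁻¹) ^ 2 * (Real.cosh a - 1)) ^ (l + 1))⁻¹) +
        Real.sqrt (3 ^ d / c₁ * ((1 - 2 * d * (η⁻¹) ^ 2 * (Real.cosh a - 1)) ^ k)⁻¹) *
          Real.sqrt ((Real.exp (a * ((L : ℝ) ^ (n + 1) - 1)) * 2) * latticeConst d (a * (L : ℝ) ^ (n + 1) - 2 * κ')) * CE * Real.sqrt μ) *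
        latticeConst d κ' * F := by
  obtain ⟨hW0, hx₀, hsup, hWd⟩ := weight_site_letters_tower L m n η ha x₀
  exact norm_GpOfUk_apply_le_rowSum L m n φ η U a' hpos' (c₁ := c₁) hR hS hPS hp₂ hCE (Real.sqrt_nonneg _) (by positivity) hlam hκ' hκ hκ₁ hP
    hdec hW0 hx₀ hsup hWd (fun ψ _ hψ => hDFS_cosh_site_diag (towerP L m (n + 1)) hk a η hη (Fact.out : 0 < c₀) hdiag hvol hlam x₀ ψ hψ)
    f hF hμ

/-- **… ON THE CHAIN's CLASS, (T) INHABITED** (`[StarRing 𝔸]`; unitary `U`, `*`-trace, compatible fibre norm — `B9Eq342GreenPrimeSupBound` §0): the same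
row-sum bound with the three standing letters `hU`, `hτ₂`, `hφ` in place of the contraction binders; remaining letters (D-P)k, (D-E)k, the masses.
[cite: Balaban1985BackgroundPropagators, Thm 3.1 (3.42) p.397, (3.39) p.397] -/
theorem norm_GpOfUk_apply_le_rowSum_cosh_unitary [StarRing 𝔸] (τ : 𝔸 →ₗ[ℂ] ℂ) (hτ₂ : ∀ X Y : 𝔸, τ (X * Y) = τ (Y * X))
    (hU : ∀ b, star (U b : 𝔸) = ((U b)⁻¹ : 𝔸ˣ)) (hφ : ∀ X Y : 𝔸, ⟪φ.symm X, φ.symm Y⟫_ℂ = τ (star X * Y))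
    {PS : TSite d m → SiteL2K ℂ d (towerP L m (n + 1)) c₀ W →L[ℂ] SiteL2K ℂ d (towerP L m (n + 1)) c₀ W}
    (hPS : ∀ (y : TSite d m) (g : SiteL2K ℂ d (towerP L m (n + 1)) c₀ W) (x : TSite d (towerP L m (n + 1))),
      WL2.equiv ℂ (fun _ : TSite d (towerP L m (n + 1)) => c₀) W (PS y g) x =
        if blockCoord (L ^ (n + 1)) m (siteCast (towerP_eq_fineP_pow L m (n + 1)) x) = y then
          WL2.equiv ℂ (fun _ : TSite d (towerP L m (n + 1)) => c₀) W g x else 0)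
    {p₂ CE κ κ' a : ℝ} (hp₂ : 0 ≤ p₂) (hCE : 0 ≤ CE) (ha : 0 ≤ a) (hlam : 0 < 1 - 2 * d * (η⁻¹) ^ 2 * (Real.cosh a - 1))
    {k : ℕ} (hk : d ≤ k) (hη : 0 < η⁻¹) (hdiag : c₀ * (η⁻¹) ^ d = c₁) (hvol : ∀ ν, η⁻¹ ≤ (towerP L m (n + 1) ν : ℝ))
    (hκ' : 0 < κ') (hκ : κ' ≤ κ) (hκ₁ : 2 * κ' < a * (L : ℝ) ^ (n + 1))
    (hP : ∀ (v : SiteL2K ℂ d (towerP L m (n + 1)) c₀ W) (x : TSite d (towerP L m (n + 1))),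
      ‖WL2.equiv ℂ _ W (laplacePrimeAk L m n φ η U a' (c₁ := c₁) v -
        covLaplaceSiteK ((η : ℂ))⁻¹ (adTransportW φ U) (adTransportW φ fun b => (U b)⁻¹) v) x‖ ≤
        p₂ * ‖PS (blockCoord (L ^ (n + 1)) m (siteCast (towerP_eq_fineP_pow L m (n + 1)) x)) v‖)
    (hdec : ∀ v y : TSite d m, ‖PS y ∘L LinearMap.toContinuousLinearMap (GpOfUk L m n φ η U a' hpos') ∘L PS v‖ ≤
      CE * Real.exp (-(κ * tdist m v y)))
    (x₀ : TSite d (towerP L m (n + 1))) (f : SiteL2K ℂ d (towerP L m (n + 1)) c₀ W) {F μ : ℝ} (hF : ∀ y, ‖WL2.equiv ℂ _ W f y‖ ≤ F)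
    (hμ : ∀ v, ‖PS v f‖ ≤ Real.sqrt μ * F) :
    ‖WL2.equiv ℂ _ W (GpOfUk L m n φ η U a' hpos' f) x₀‖ ≤
      ((1 + p₂ * CE * Real.sqrt μ) * (Real.exp (a * ((L : ℝ) ^ (n + 1) - 1)) * 2) *
            (∑ l ∈ Finset.range k, ((1 - 2 * d * (η⁻¹) ^ 2 * (Real.cosh a - 1)) ^ (l + 1))⁻¹) +
        Real.sqrt (3 ^ d / c₁ * ((1 - 2 * d * (η⁻¹) ^ 2 * (Real.cosh a - 1)) ^ k)⁻¹) *
          Real.sqrt ((Real.exp (a * ((L : ℝ) ^ (n + 1) - 1)) * 2) * latticeConst d (a * (L : ℝ) ^ (n + 1) - 2 * κ')) * CE * Real.sqrt μ) *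
        latticeConst d κ' * F :=
  norm_GpOfUk_apply_le_rowSum_cosh L m n φ η U a' hpos' (fun b w => (norm_adTransportW_eq φ U τ hτ₂ hU hφ b w).le)
    (fun b w => (norm_adTransportW_inv_eq φ U τ hτ₂ hU hφ b w).le) hPS hp₂ hCE ha hlam hk hη hdiag hvol hκ' hκ hκ₁ hP hdec x₀ f hF hμ

/-! ## §2 On the diagonal `ηL^{n+1} = 1`: every constant free of the height, of `L` and of the volume -/

/-- **THE ROW SUM OF (3.42) FOR `G′_k(U)` WITH HEIGHT-FREE CONSTANTS** (`1 ≤ d`; the diagonal `η⁻¹ = L^{n+1}`, `c₀(L^{n+1})^d = c₁`; `d ≤ k`; rates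
`0 < κ′ ≤ κ`, `2κ′ < 1∕√(4d+1)`): at the rate `a⋆ = √(1∕(4d(L^{n+1})² + 1))` of `rate_explicit` one has `λ ≥ 1∕2`, `a⋆L^{n+1} ≥ 1∕√(4d+1)`, `a⋆(L^{n+1} − 1) ≤ 1∕2`,
hence for EVERY `f` (`‖f(x)‖ ≤ F`, `‖P_vf‖ ≤ √μF`):
`‖(G′_k(U)f)(x₀)‖ ≤ ((1 + p₂C_E√μ)·(2e^{1∕2})·Σ_{l<k}2^{l+1} + √(3^d∕c₁·2^k)·√(2e^{1∕2}·K_d(1∕√(4d+1) − 2κ′))·C_E·√μ)·K_d(κ′)·F` — NO `n`, NO `L`, NO `m`, NO `η` in the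
constant: print's «B₀ dependent on d only», modulo (T), (D-P)k (`p₂`), (D-E)k (`C_E, κ`) and the masses (`μ`).
[cite: Balaban1985BackgroundPropagators, Thm 3.1 (3.42) p.397, (3.39) p.397, (3.49) p.399; Balaban1984PropagatorsI, p.36] -/
theorem norm_GpOfUk_apply_le_rowSum_heightFree (hd : 1 ≤ d)
    (hR : ∀ b w, ‖adTransportW φ U b w‖ ≤ ‖w‖) (hS : ∀ b w, ‖adTransportW φ (fun b => (U b)⁻¹) b w‖ ≤ ‖w‖)
    {PS : TSite d m → SiteL2K ℂ d (towerP L m (n + 1)) c₀ W →L[ℂ] SiteL2K ℂ d (towerP L m (n + 1)) c₀ W}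
    (hPS : ∀ (y : TSite d m) (g : SiteL2K ℂ d (towerP L m (n + 1)) c₀ W) (x : TSite d (towerP L m (n + 1))),
      WL2.equiv ℂ (fun _ : TSite d (towerP L m (n + 1)) => c₀) W (PS y g) x =
        if blockCoord (L ^ (n + 1)) m (siteCast (towerP_eq_fineP_pow L m (n + 1)) x) = y then
          WL2.equiv ℂ (fun _ : TSite d (towerP L m (n + 1)) => c₀) W g x else 0)
    {p₂ CE κ κ' : ℝ} (hp₂ : 0 ≤ p₂) (hCE : 0 ≤ CE) (hκ' : 0 < κ') (hκ : κ' ≤ κ) (h2κ : 2 * κ' < Real.sqrt (1 / (4 * d + 1)))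
    (hηN : η⁻¹ = (L : ℝ) ^ (n + 1)) (hdiag : c₀ * ((L : ℝ) ^ (n + 1)) ^ d = c₁) {k : ℕ} (hk : d ≤ k)
    (hP : ∀ (v : SiteL2K ℂ d (towerP L m (n + 1)) c₀ W) (x : TSite d (towerP L m (n + 1))),
      ‖WL2.equiv ℂ _ W (laplacePrimeAk L m n φ η U a' (c₁ := c₁) v -
        covLaplaceSiteK ((η : ℂ))⁻¹ (adTransportW φ U) (adTransportW φ fun b => (U b)⁻¹) v) x‖ ≤
        p₂ * ‖PS (blockCoord (L ^ (n + 1)) m (siteCast (towerP_eq_fineP_pow L m (n + 1)) x)) v‖)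
    (hdec : ∀ v y : TSite d m, ‖PS y ∘L LinearMap.toContinuousLinearMap (GpOfUk L m n φ η U a' hpos') ∘L PS v‖ ≤
      CE * Real.exp (-(κ * tdist m v y)))
    (x₀ : TSite d (towerP L m (n + 1))) (f : SiteL2K ℂ d (towerP L m (n + 1)) c₀ W) {F μ : ℝ} (hF : ∀ y, ‖WL2.equiv ℂ _ W f y‖ ≤ F)
    (hμ : ∀ v, ‖PS v f‖ ≤ Real.sqrt μ * F) :
    ‖WL2.equiv ℂ _ W (GpOfUk L m n φ η U a' hpos' f) x₀‖ ≤
      ((1 + p₂ * CE * Real.sqrt μ) * (Real.exp (1 / 2) * 2) * (∑ l ∈ Finset.range k, (2 : ℝ) ^ (l + 1)) +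
        Real.sqrt (3 ^ d / c₁ * 2 ^ k) * Real.sqrt ((Real.exp (1 / 2) * 2) * latticeConst d (Real.sqrt (1 / (4 * d + 1)) - 2 * κ')) *
          CE * Real.sqrt μ) * latticeConst d κ' * F := by
  have hc₁ : 0 < c₁ := Fact.out
  have hL1 : (1 : ℝ) ≤ L := by exact_mod_cast Nat.one_le_iff_ne_zero.mpr (NeZero.ne L)
  set N : ℝ := (L : ℝ) ^ (n + 1)
  have hN1 : 1 ≤ N := one_le_pow₀ hL1
  have hN0 : 0 < N := lt_of_lt_of_le one_pos hN1
  -- the explicit rate and its three letters (`m = 1`, `t = N`)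
  obtain ⟨ha0, _, hlam2, hκN⟩ := rate_explicit (d := d) N 1 one_pos hN1
  set a : ℝ := Real.sqrt (1 / (4 * d * N ^ 2 + 1))
  have ha : 0 ≤ a := ha0.le
  -- `λ ≥ 1∕2` read at `η⁻¹ = N`
  have hlam' : 1 / 2 ≤ 1 - 2 * d * (η⁻¹) ^ 2 * (Real.cosh a - 1) := by rw [hηN]; simpa using hlam2
  have hlam : 0 < 1 - 2 * d * (η⁻¹) ^ 2 * (Real.cosh a - 1) := lt_of_lt_of_le (by norm_num) hlam'
  -- the block rate `aN ≥ 1∕√(4d+1)` and `a(N−1) ≤ aN ≤ 1∕2`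
  have hκN' : Real.sqrt (1 / (4 * d + 1)) ≤ a * N := by simpa using hκN
  have hκ₁ : 2 * κ' < a * (L : ℝ) ^ (n + 1) := lt_of_lt_of_le h2κ hκN'
  have hq : (0 : ℝ) < 1 / (4 * d * N ^ 2 + 1) := by positivity
  have haN : a * N ≤ 1 / 2 := by
    have e : a * N = Real.sqrt (1 / (4 * d * N ^ 2 + 1) * N ^ 2) := by
      rw [Real.sqrt_mul hq.le, Real.sqrt_sq hN0.le]
    rw [e, show (1 / 2 : ℝ) = Real.sqrt ((1 / 2) ^ 2) by rw [Real.sqrt_sq (by norm_num)]]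
    refine Real.sqrt_le_sqrt ?_
    have hd' : (1 : ℝ) ≤ d := by exact_mod_cast hd
    rw [div_mul_eq_mul_div, one_mul, div_le_iff₀ (by positivity)]
    nlinarith [sq_nonneg N]
  have haN1 : a * (N - 1) ≤ 1 / 2 := by nlinarith
  -- the diagonal letters of the (D-FS) supplier
  have hη : 0 < η⁻¹ := by rw [hηN]; exact hN0
  have hdiag' : c₀ * (η⁻¹) ^ d = c₁ := by rw [hηN]; exact hdiag
  have hvol : ∀ ν, η⁻¹ ≤ (towerP L m (n + 1) ν : ℝ) := fun ν => by
    rw [hηN, towerP_apply]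
    push_cast
    have h1 : (1 : ℝ) ≤ (m ν : ℝ) := by exact_mod_cast Nat.one_le_iff_ne_zero.mpr (NeZero.ne (m ν))
    nlinarith
  -- the row at the rate `a⋆`
  have h := norm_GpOfUk_apply_le_rowSum_cosh L m n φ η U a' hpos' (c₁ := c₁) hR hS hPS hp₂ hCE ha hlam hk hη hdiag' hvol hκ' hκ hκ₁ hP hdec
    x₀ f hF hμ
  refine h.trans ?_
  -- bookkeeping: every height-dependent constant against its height-free majorant
  have hF0 : 0 ≤ F := (norm_nonneg _).trans (hF x₀)
  have hK0 : 0 ≤ latticeConst d κ' := latticeConst_nonneg d hκ'.le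
  set lam : ℝ := 1 - 2 * d * (η⁻¹) ^ 2 * (Real.cosh a - 1)
  have hpow : ∀ j : ℕ, (lam ^ j)⁻¹ ≤ (2 : ℝ) ^ j := fun j => by
    have h1 : ((1 / 2 : ℝ) ^ j) ≤ lam ^ j := pow_le_pow_left₀ (by norm_num) hlam' j
    calc (lam ^ j)⁻¹ ≤ ((1 / 2 : ℝ) ^ j)⁻¹ := inv_anti₀ (pow_pos (by norm_num) j) h1
      _ = 2 ^ j := by rw [one_div, inv_pow, inv_inv]
  have hM : Real.exp (a * (N - 1)) * 2 ≤ Real.exp (1 / 2) * 2 :=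
    mul_le_mul_of_nonneg_right (Real.exp_le_exp.2 haN1) zero_le_two
  have hM0 : 0 ≤ Real.exp (a * (N - 1)) * 2 := by positivity
  have hKa : latticeConst d (a * N - 2 * κ') ≤ latticeConst d (Real.sqrt (1 / (4 * d + 1)) - 2 * κ') :=
    latticeConst_anti hd (by linarith) (by linarith)
  have hKa0 : 0 ≤ latticeConst d (a * N - 2 * κ') := latticeConst_nonneg d (by linarith)
  have hsum : ∑ l ∈ Finset.range k, (lam ^ (l + 1))⁻¹ ≤ ∑ l ∈ Finset.range k, (2 : ℝ) ^ (l + 1) :=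
    Finset.sum_le_sum fun l _ => hpow (l + 1)
  have hsum0 : 0 ≤ ∑ l ∈ Finset.range k, (lam ^ (l + 1))⁻¹ := Finset.sum_nonneg fun l _ => inv_nonneg.2 (pow_nonneg hlam.le _)
  have hB₁ : (1 + p₂ * CE * Real.sqrt μ) * (Real.exp (a * (N - 1)) * 2) * (∑ l ∈ Finset.range k, (lam ^ (l + 1))⁻¹) ≤
      (1 + p₂ * CE * Real.sqrt μ) * (Real.exp (1 / 2) * 2) * (∑ l ∈ Finset.range k, (2 : ℝ) ^ (l + 1)) := by
    have h0 : 0 ≤ 1 + p₂ * CE * Real.sqrt μ := by positivity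
    exact mul_le_mul (mul_le_mul_of_nonneg_left hM h0) hsum hsum0 (mul_nonneg h0 (by positivity))
  have hC₃ : Real.sqrt (3 ^ d / c₁ * (lam ^ k)⁻¹) ≤ Real.sqrt (3 ^ d / c₁ * 2 ^ k) :=
    Real.sqrt_le_sqrt (mul_le_mul_of_nonneg_left (hpow k) (by positivity))
  have hMK : Real.sqrt ((Real.exp (a * (N - 1)) * 2) * latticeConst d (a * N - 2 * κ')) ≤
      Real.sqrt ((Real.exp (1 / 2) * 2) * latticeConst d (Real.sqrt (1 / (4 * d + 1)) - 2 * κ')) :=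
    Real.sqrt_le_sqrt (mul_le_mul hM hKa hKa0 (by positivity))
  have hB₂ : Real.sqrt (3 ^ d / c₁ * (lam ^ k)⁻¹) * Real.sqrt ((Real.exp (a * (N - 1)) * 2) * latticeConst d (a * N - 2 * κ')) * CE *
        Real.sqrt μ ≤
      Real.sqrt (3 ^ d / c₁ * 2 ^ k) * Real.sqrt ((Real.exp (1 / 2) * 2) * latticeConst d (Real.sqrt (1 / (4 * d + 1)) - 2 * κ')) * CE *
        Real.sqrt μ := by
    gcongr
  have hB := add_le_add hB₁ hB₂
  exact mul_le_mul_of_nonneg_right (mul_le_mul_of_nonneg_right hB hK0) hF0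

/-- **… ON THE CHAIN's CLASS, (T) INHABITED** (`[StarRing 𝔸]`): the height-free row sum with the standing letters `hU`, `hτ₂`, `hφ` in place of the
contraction binders. [cite: Balaban1985BackgroundPropagators, Thm 3.1 (3.42) p.397, (3.39) p.397] -/
theorem norm_GpOfUk_apply_le_rowSum_heightFree_unitary [StarRing 𝔸] (hd : 1 ≤ d) (τ : 𝔸 →ₗ[ℂ] ℂ) (hτ₂ : ∀ X Y : 𝔸, τ (X * Y) = τ (Y * X))
    (hU : ∀ b, star (U b : 𝔸) = ((U b)⁻¹ : 𝔸ˣ)) (hφ : ∀ X Y : 𝔸, ⟪φ.symm X, φ.symm Y⟫_ℂ = τ (star X * Y))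
    {PS : TSite d m → SiteL2K ℂ d (towerP L m (n + 1)) c₀ W →L[ℂ] SiteL2K ℂ d (towerP L m (n + 1)) c₀ W}
    (hPS : ∀ (y : TSite d m) (g : SiteL2K ℂ d (towerP L m (n + 1)) c₀ W) (x : TSite d (towerP L m (n + 1))),
      WL2.equiv ℂ (fun _ : TSite d (towerP L m (n + 1)) => c₀) W (PS y g) x =
        if blockCoord (L ^ (n + 1)) m (siteCast (towerP_eq_fineP_pow L m (n + 1)) x) = y then
          WL2.equiv ℂ (fun _ : TSite d (towerP L m (n + 1)) => c₀) W g x else 0)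
    {p₂ CE κ κ' : ℝ} (hp₂ : 0 ≤ p₂) (hCE : 0 ≤ CE) (hκ' : 0 < κ') (hκ : κ' ≤ κ) (h2κ : 2 * κ' < Real.sqrt (1 / (4 * d + 1)))
    (hηN : η⁻¹ = (L : ℝ) ^ (n + 1)) (hdiag : c₀ * ((L : ℝ) ^ (n + 1)) ^ d = c₁) {k : ℕ} (hk : d ≤ k)
    (hP : ∀ (v : SiteL2K ℂ d (towerP L m (n + 1)) c₀ W) (x : TSite d (towerP L m (n + 1))),
      ‖WL2.equiv ℂ _ W (laplacePrimeAk L m n φ η U a' (c₁ := c₁) v -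
        covLaplaceSiteK ((η : ℂ))⁻¹ (adTransportW φ U) (adTransportW φ fun b => (U b)⁻¹) v) x‖ ≤
        p₂ * ‖PS (blockCoord (L ^ (n + 1)) m (siteCast (towerP_eq_fineP_pow L m (n + 1)) x)) v‖)
    (hdec : ∀ v y : TSite d m, ‖PS y ∘L LinearMap.toContinuousLinearMap (GpOfUk L m n φ η U a' hpos') ∘L PS v‖ ≤
      CE * Real.exp (-(κ * tdist m v y)))
    (x₀ : TSite d (towerP L m (n + 1))) (f : SiteL2K ℂ d (towerP L m (n + 1)) c₀ W) {F μ : ℝ} (hF : ∀ y, ‖WL2.equiv ℂ _ W f y‖ ≤ F)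
    (hμ : ∀ v, ‖PS v f‖ ≤ Real.sqrt μ * F) :
    ‖WL2.equiv ℂ _ W (GpOfUk L m n φ η U a' hpos' f) x₀‖ ≤
      ((1 + p₂ * CE * Real.sqrt μ) * (Real.exp (1 / 2) * 2) * (∑ l ∈ Finset.range k, (2 : ℝ) ^ (l + 1)) +
        Real.sqrt (3 ^ d / c₁ * 2 ^ k) * Real.sqrt ((Real.exp (1 / 2) * 2) * latticeConst d (Real.sqrt (1 / (4 * d + 1)) - 2 * κ')) *
          CE * Real.sqrt μ) * latticeConst d κ' * F :=
  norm_GpOfUk_apply_le_rowSum_heightFree L m n φ η U a' hpos' hd (fun b w => (norm_adTransportW_eq φ U τ hτ₂ hU hφ b w).le)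
    (fun b w => (norm_adTransportW_inv_eq φ U τ hτ₂ hU hφ b w).le) hPS hp₂ hCE hκ' hκ h2κ hηN hdiag hk hP hdec x₀ f hF hμ

end Literature.MathematicalPhysics.QuantumFieldTheory.Balaban1983to89.B9Eq342GreenPrimeTowerSupBoundDecayCosh

end
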